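import Literature.NumberTheory.EllipticCurves.BhargavaShankarLocalMassesProofs
import Literature.NumberTheory.EllipticCurves.BhargavaShankarClassCountProofs
import Literature.NumberTheory.EllipticCurves.BhargavaShankarTwoTorsionProofs
import Literature.NumberTheory.EllipticCurves.BinaryQuarticMinimisationTwoProofs
import Mathlib.NumberTheory.EulerProduct.Basic
import Mathlib.NumberTheory.ZetaValues
import Mathlib.NumberTheory.SumPrimeReciprocals
import Mathlib.Analysis.SpecialFunctions.Log.Summable
import HarnessLib

/-!
# Bhargava–Shankar, eq. (31) assembled: `Σ_{H(E)<X} #{irreducible locally soluble classes}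
# = 2·c_F·X^{5/6} + o(X^{5/6})` from the sieve step (†), Thm 2.1 and Lemma 5.16

`Proofs` companion of `BhargavaShankarLocalMasses.lean` (theorems only). It derives the tree's
rendering of eq. (31), the named fact
`Literature.NumberTheory.EllipticCurves.bhargavaShankar_sum_irredClassCount_asymptotic`
(`BhargavaShankarCounting.lean`), from

* the sieve step (†) = second line of display (31) of the source
  (`bhargavaShankar_locSolIrredClassCount_asymptotic`, `BhargavaShankarLocalMasses.lean`),
* Thm 2.1 (`bhargavaShankar_classCount`, `BinaryQuarticForms.lean`), and
* Lemma 5.16 (Brumer–Kramer, `brumerKramer_card_quotient_two`, `BhargavaShankarCounting.lean`),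

following lines 3–4 of display (31) and the last display of §5.4 of the held arXiv text
`arXiv:1006.1002v2` (p. 34–35): `N(V_ℤ^{(0)} ∪ V_ℤ^{(2+)} ∪ V_ℤ^{(1)}; Y) ~ (4/135 + 4/135 +
32/135)ζ(2)Y^{5/6} = (8/27)ζ(2)Y^{5/6}` (Thm 2.1 with `N(V^{(2+)}) = N(V^{(2)})/2`,
`BinaryQuarticRealTypesProofs`), `∏_p |2¹⁰/3³|_p M_p(V,F) = ∏_p |2¹⁰/3³|_p (1 − p⁻²) c_p |3⁴|_p
(1 − p⁻¹⁰) = (27/2¹⁰)(1/3⁴)·2·ζ(2)⁻¹·∏_p(1 − p⁻¹⁰)` (`localMassV_eq`, `localMassU_eq`, the Euler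
product `∏_p (1 − p⁻²) = 6/π²`), and `N(S^F; 2¹⁰·27·X) = Σ_{H(E_{A,B})<X} #{classes}`
(`sum_pgl2QClassCount_eq_locSolIrredClassCount`); the constants combine to
`(8/27)(π²/6)·(2¹⁰·27)^{5/6}·∏_p(…) = 2·c_F` with `c_F = heightFamilyConstant =
4/(4^{1/3}27^{1/2})·∏_p(1 − p⁻¹⁰)` (Lemma 5.15).

Consequently Theorem 1.1 and Cor. 1.2 (`averageRankLE_three_halves`) hold granted Lemma 5.2
(`bhargavaShankar_card_selmerTwo_eq_kEquivClassCount`), the sieve step (†), Thm 2.1 and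
Lemma 5.16 — four named inputs, each a single printed statement — everything else being proved:
`averageRankLE_three_halves_of_sieve_facts`.

## References

* M. Bhargava, A. Shankar, Ann. of Math. (2) 181 (2015) 191–242 = arXiv:1006.1002, §5.4
  (eq. (31), Lemma 5.15, Lemma 5.16), Thm 2.1, Prop. 2.10. [cite: BhargavaShankarAnnals2015, §5.4 eq. (31) (arXiv:1006.1002v2 numbering)]
-/

noncomputable section

open scoped Classical
open Filter Topology Finset

namespace Literature.NumberTheory.EllipticCurves

open BinaryQuartic

/-! ## Euler products over the primes -/

/-- Inverting a convergent infinite product of reals with nonzero value. [folklore] -/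
theorem hasProd_inv₀ {β : Type*} {f : β → ℝ} {a : ℝ} (h : HasProd f a) (ha : a ≠ 0) :
    HasProd (fun b ↦ (f b)⁻¹) a⁻¹ := by
  unfold HasProd at h ⊢
  simpa only [Finset.prod_inv_distrib] using h.inv₀ ha

/-- **The Euler product `∏_p (1 − p⁻²) = 6/π² = ζ(2)⁻¹`** (real form; Mathlib's Euler product
for the completely multiplicative function `n ↦ 1/n²` and `Σ 1/n² = π²/6`). [folklore] -/
theorem hasProd_one_sub_inv_sq :
    HasProd (fun p : Nat.Primes ↦ (1 - 1 / ((p : ℕ) : ℝ) ^ 2)) (6 / Real.pi ^ 2) := by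
  let F : ℕ →*₀ ℝ :=
    { toFun := fun n ↦ ((n : ℝ) ^ 2)⁻¹
      map_zero' := by simp
      map_one' := by simp
      map_mul' := fun m n ↦ by push_cast; rw [mul_pow, mul_inv] }
  have hF : ∀ n : ℕ, F n = ((n : ℝ) ^ 2)⁻¹ := fun n ↦ rfl
  have hsum : Summable (fun n : ℕ ↦ ‖F n‖) := by
    simp only [hF, norm_inv, norm_pow, Real.norm_natCast]
    exact Real.summable_nat_pow_inv.mpr (by norm_num)
  have h := EulerProduct.eulerProduct_completely_multiplicative_hasProd hsum
  have htsum : ∑' n : ℕ, F n = Real.pi ^ 2 / 6 := by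
    rw [← hasSum_zeta_two.tsum_eq]
    congr 1; ext n; simp [hF, one_div]
  rw [htsum] at h
  have h' := hasProd_inv₀ h (by positivity)
  rw [inv_div] at h'
  convert h' using 1
  ext p
  simp [hF, one_div]

/-- The Euler factor `∏_p (1 − p⁻¹⁰)` of `heightFamilyConstant` converges. [folklore] -/
theorem hasProd_one_sub_inv_pow_ten :
    HasProd (fun p : Nat.Primes ↦ (1 - 1 / ((p : ℕ) : ℝ) ^ 10))
      (∏' p : Nat.Primes, (1 - 1 / ((p : ℕ) : ℝ) ^ 10)) := by
  refine Multipliable.hasProd ?_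
  have hs : Summable (fun p : Nat.Primes ↦ -(1 / ((p : ℕ) : ℝ) ^ 10)) := by
    refine Summable.neg ?_
    have := Nat.Primes.summable_rpow.mpr (by norm_num : (-10 : ℝ) < -1)
    refine this.congr fun p ↦ ?_
    rw [Real.rpow_neg (Nat.cast_nonneg _), one_div]
    norm_cast
  simpa [sub_eq_add_neg] using Real.multipliable_one_add_of_summable hs

/-! ## The local factors `|2¹⁰/3³|_p · M_p(V,F)` -/

/-- `|2¹⁰/3³|_p = 2⁻¹⁰` (`p = 2`), `3³` (`p = 3`), `1` otherwise. [folklore] -/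
theorem padicNorm_two_pow_ten_div (p : ℕ) [hp : Fact p.Prime] :
    (padicNorm p ((2 : ℚ) ^ 10 / 3 ^ 3) : ℝ) =
      if p = 2 then ((2 : ℝ) ^ 10)⁻¹ else if p = 3 then (3 : ℝ) ^ 3 else 1 := by
  have hP : p.Prime := hp.out
  have h2 : padicNorm p ((2 : ℚ) ^ 10) = if p = 2 then ((2 : ℚ) ^ 10)⁻¹ else 1 := by
    split_ifs with h
    · subst h
      rw [IsAbsoluteValue.abv_pow (padicNorm 2), show (2 : ℚ) = ((2 : ℕ) : ℚ) by norm_num,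
        padicNorm.padicNorm_p_of_prime]; push_cast; rw [inv_pow]
    · rw [show ((2 : ℚ) ^ 10) = ((2 ^ 10 : ℕ) : ℚ) by norm_num, padicNorm.nat_eq_one_iff]
      intro hd
      exact h ((Nat.prime_dvd_prime_iff_eq hP Nat.prime_two).mp (hP.dvd_of_dvd_pow hd))
  have h3 : padicNorm p ((3 : ℚ) ^ 3) = if p = 3 then ((3 : ℚ) ^ 3)⁻¹ else 1 := by
    split_ifs with h
    · subst h
      rw [IsAbsoluteValue.abv_pow (padicNorm 3), show (3 : ℚ) = ((3 : ℕ) : ℚ) by norm_num,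
        padicNorm.padicNorm_p_of_prime]; push_cast; rw [inv_pow]
    · rw [show ((3 : ℚ) ^ 3) = ((3 ^ 3 : ℕ) : ℚ) by norm_num, padicNorm.nat_eq_one_iff]
      intro hd
      exact h ((Nat.prime_dvd_prime_iff_eq hP Nat.prime_three).mp (hP.dvd_of_dvd_pow hd))
  rw [padicNorm.div, h2, h3]
  by_cases hp2 : p = 2
  · subst hp2; simp
  · by_cases hp3 : p = 3
    · subst hp3; simp
    · simp [hp2, hp3]

/-- **The local factor at `p`**, granted Lemma 5.16:
`|2¹⁰/3³|_p · M_p(V,F) = g_p · (1 − p⁻²) · (1 − p⁻¹⁰)` with `g_p = |2¹⁰/3³|_p · c_p · |3⁴|_p`,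
i.e. `g₂ = 2⁻⁹`, `g₃ = 3⁻¹`, `g_p = 1` otherwise (`localMassV_eq`, `localMassU_eq`).
[cite: BhargavaShankarAnnals2015, §5.4 (last display) and Prop. 5.12 (arXiv:1006.1002v2 numbering)] -/
theorem localFactor_eq (hBK : brumerKramer_card_quotient_two) (p : ℕ) [hp : Fact p.Prime] :
    (padicNorm p ((2 : ℚ) ^ 10 / 3 ^ 3) : ℝ) * localMassV p =
      (if p = 2 then ((2 : ℝ) ^ 9)⁻¹ else if p = 3 then (3 : ℝ)⁻¹ else 1) *
        (1 - 1 / (p : ℝ) ^ 2) * (1 - 1 / (p : ℝ) ^ 10) := by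
  rw [localMassV_eq p hBK, localMassU_eq p, padicNorm_three_pow_four p, padicNorm_two_pow_ten_div p]
  by_cases hp2 : p = 2
  · subst hp2; norm_num
  · by_cases hp3 : p = 3
    · subst hp3; norm_num
    · simp only [hp2, hp3, if_false]; ring

/-- **`∏_p |2¹⁰/3³|_p M_p(V,F) = (2⁻⁹·3⁻¹)·(6/π²)·∏_p (1 − p⁻¹⁰)`**, granted Lemma 5.16
(the Euler product `ζ(2)∏_p(1 − p⁻²) = 1` of the last display of §5.4).
[cite: BhargavaShankarAnnals2015, §5.4 (last display; arXiv:1006.1002v2 numbering)] -/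
theorem hasProd_localFactor (hBK : brumerKramer_card_quotient_two) :
    HasProd (fun p : Nat.Primes ↦ ((padicNorm p ((2 : ℚ) ^ 10 / 3 ^ 3) : ℚ) : ℝ) * @localMassV p ⟨p.2⟩)
      (((2 : ℝ) ^ 9)⁻¹ * (3 : ℝ)⁻¹ * (6 / Real.pi ^ 2) *
        ∏' p : Nat.Primes, (1 - 1 / ((p : ℕ) : ℝ) ^ 10)) := by
  set g : Nat.Primes → ℝ := fun p ↦
    if (p : ℕ) = 2 then ((2 : ℝ) ^ 9)⁻¹ else if (p : ℕ) = 3 then (3 : ℝ)⁻¹ else 1 with hg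
  have p2 : Nat.Primes := ⟨2, Nat.prime_two⟩
  set s : Finset Nat.Primes := {⟨2, Nat.prime_two⟩, ⟨3, Nat.prime_three⟩} with hs
  have hgprod : HasProd g (((2 : ℝ) ^ 9)⁻¹ * (3 : ℝ)⁻¹) := by
    have h1 : ∀ b ∉ s, g b = 1 := by
      intro b hb
      simp only [hs, Finset.mem_insert, Finset.mem_singleton, not_or] at hb
      have hb2 : (b : ℕ) ≠ 2 := fun h ↦ hb.1 (Subtype.ext h)
      have hb3 : (b : ℕ) ≠ 3 := fun h ↦ hb.2 (Subtype.ext h)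
      simp [hg, hb2, hb3]
    have h2 := hasProd_prod_of_ne_finset_one (L := SummationFilter.unconditional _) h1
    have hval : ∏ b ∈ s, g b = ((2 : ℝ) ^ 9)⁻¹ * (3 : ℝ)⁻¹ := by
      rw [hs, Finset.prod_insert (by decide), Finset.prod_singleton]
      simp [hg]
    rwa [hval] at h2
  have hall := (hgprod.mul hasProd_one_sub_inv_sq).mul hasProd_one_sub_inv_pow_ten
  convert hall using 1
  ext p
  haveI : Fact (p : ℕ).Prime := ⟨p.2⟩
  have := localFactor_eq hBK (p : ℕ)
  simp only [hg]
  convert this using 2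

/-! ## `N(V_ℤ^{(0)} ∪ V_ℤ^{(2+)} ∪ V_ℤ^{(1)}; Y) ~ (8/27)ζ(2) Y^{5/6}` -/

/-- **Third line of display (31)**: `N(V_ℤ^{(0)} ∪ V_ℤ^{(2+)} ∪ V_ℤ^{(1)}; Y)
= (4/135 + ½·8/135 + 32/135)ζ(2)Y^{5/6} + O(Y^{3/4+1/24}) = (8/27)ζ(2)Y^{5/6} + O(Y^{19/24})`,
from Thm 2.1, the symmetry `N(V^{(2)}) = 2N(V^{(2+)})` and additivity over the real types.
[cite: BhargavaShankarAnnals2015, §5.4 eq. (31) (third line) and Thm 2.1 (arXiv:1006.1002v2 numbering)] -/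
theorem abs_classCount_union_sub_le (h16 : bhargavaShankar_classCount) :
    ∃ C : ℝ, ∀ Y : ℝ, 1 ≤ Y →
      |(gl2zClassCount (fourRealRoots ∪ posDefinite ∪ twoRealRoots) Y : ℝ) -
          8 / 27 * (Real.pi ^ 2 / 6) * Y ^ (5 / 6 : ℝ)| ≤ C * Y ^ (3 / 4 + 1 / 24 : ℝ) := by
  obtain ⟨C, hC⟩ := h16 (1 / 24) (by norm_num)
  refine ⟨5 / 2 * C, fun Y hY ↦ ?_⟩
  obtain ⟨h0, h1, h2⟩ := hC Y hY
  obtain ⟨f0, f1, -, fpos⟩ := finite_orbits_of_classCount h16 Y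
  have hsum := gl2zClassCount_union_three Y f0 fpos f1
  have hsym := gl2zClassCount_noRealRoots Y
  have hpos : (gl2zClassCount posDefinite Y : ℝ) = (gl2zClassCount noRealRoots Y : ℝ) / 2 := by
    rw [hsym]; push_cast; ring
  rw [hsum]
  push_cast
  rw [hpos]
  set A : ℝ := (gl2zClassCount fourRealRoots Y : ℝ) - 4 / 135 * (Real.pi ^ 2 / 6) * Y ^ (5 / 6 : ℝ)
    with hA
  set B : ℝ := (gl2zClassCount noRealRoots Y : ℝ) - 8 / 135 * (Real.pi ^ 2 / 6) * Y ^ (5 / 6 : ℝ)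
    with hB
  set D : ℝ := (gl2zClassCount twoRealRoots Y : ℝ) - 32 / 135 * (Real.pi ^ 2 / 6) * Y ^ (5 / 6 : ℝ)
    with hD
  have key : (gl2zClassCount fourRealRoots Y : ℝ) + (gl2zClassCount noRealRoots Y : ℝ) / 2 +
      (gl2zClassCount twoRealRoots Y : ℝ) - 8 / 27 * (Real.pi ^ 2 / 6) * Y ^ (5 / 6 : ℝ) =
      A + B / 2 + D := by
    rw [hA, hB, hD]; ring
  rw [key]
  have hB2 : |B / 2| = |B| / 2 := by rw [abs_div, abs_two]
  calc |A + B / 2 + D| ≤ |A + B / 2| + |D| := abs_add_le _ _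
    _ ≤ |A| + |B / 2| + |D| := by gcongr; exact abs_add_le _ _
    _ = |A| + |B| / 2 + |D| := by rw [hB2]
    _ ≤ C * Y ^ (3 / 4 + 1 / 24 : ℝ) + C * Y ^ (3 / 4 + 1 / 24 : ℝ) / 2 +
          C * Y ^ (3 / 4 + 1 / 24 : ℝ) := by gcongr
    _ = 5 / 2 * C * Y ^ (3 / 4 + 1 / 24 : ℝ) := by ring

/-! ## Assembly of eq. (31) -/

/-- The constant: `(8/27)(π²/6)·(2¹⁰·27)^{5/6}·[2⁻⁹·3⁻¹·(6/π²)] = 8/(4^{1/3}·27^{1/2})`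
(both equal `2^{7/3}·3^{−3/2}`; compare sixth powers). [folklore] -/
theorem eq31_constant :
    8 / 27 * (Real.pi ^ 2 / 6) * ((2 : ℝ) ^ 10 * 27) ^ (5 / 6 : ℝ) *
        (((2 : ℝ) ^ 9)⁻¹ * (3 : ℝ)⁻¹ * (6 / Real.pi ^ 2)) =
      2 * (4 / ((4 : ℝ) ^ (1 / 3 : ℝ) * (27 : ℝ) ^ (1 / 2 : ℝ))) := by
  have hπ : Real.pi ^ 2 ≠ 0 := by positivity
  -- reduce to an identity between positive real powers
  have hL : 8 / 27 * (Real.pi ^ 2 / 6) * ((2 : ℝ) ^ 10 * 27) ^ (5 / 6 : ℝ) *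
      (((2 : ℝ) ^ 9)⁻¹ * (3 : ℝ)⁻¹ * (6 / Real.pi ^ 2)) =
      ((2 : ℝ) ^ 10 * 27) ^ (5 / 6 : ℝ) / 5184 := by
    field_simp; ring
  rw [hL]
  have h4 : (0 : ℝ) < (4 : ℝ) ^ (1 / 3 : ℝ) := Real.rpow_pos_of_pos (by norm_num) _
  have h27 : (0 : ℝ) < (27 : ℝ) ^ (1 / 2 : ℝ) := Real.rpow_pos_of_pos (by norm_num) _
  have hA : (0 : ℝ) < ((2 : ℝ) ^ 10 * 27) ^ (5 / 6 : ℝ) / 5184 :=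
    div_pos (Real.rpow_pos_of_pos (by norm_num) _) (by norm_num)
  have hB : (0 : ℝ) < 2 * (4 / ((4 : ℝ) ^ (1 / 3 : ℝ) * (27 : ℝ) ^ (1 / 2 : ℝ))) := by positivity
  -- sixth powers agree
  refine (pow_left_inj₀ hA.le hB.le (by norm_num : (6 : ℕ) ≠ 0)).mp ?_
  have e1 : (((2 : ℝ) ^ 10 * 27) ^ (5 / 6 : ℝ)) ^ 6 = ((2 : ℝ) ^ 10 * 27) ^ 5 := by
    rw [← Real.rpow_natCast, ← Real.rpow_mul (by norm_num)]; norm_num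
  have e2 : ((4 : ℝ) ^ (1 / 3 : ℝ)) ^ 6 = 4 ^ 2 := by
    rw [← Real.rpow_natCast, ← Real.rpow_mul (by norm_num)]; norm_num
  have e3 : ((27 : ℝ) ^ (1 / 2 : ℝ)) ^ 6 = 27 ^ 3 := by
    rw [← Real.rpow_natCast, ← Real.rpow_mul (by norm_num)]; norm_num
  simp only [div_pow, mul_pow, e1, e2, e3]
  norm_num

/-- **Bhargava–Shankar, eq. (31) for the family of all elliptic curves, in the tree's
normalisation** — `Σ_{H(E_{A,B}) < X} #{PGL₂(ℚ)-classes of locally soluble irreducible integral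
quartics with invariants 2⁴I(E), 2⁶J(E)} = 2·c_F·X^{5/6} + o(X^{5/6})`
(`bhargavaShankar_sum_irredClassCount_asymptotic`) — **derived from** the sieve step (†)
(`bhargavaShankar_locSolIrredClassCount_asymptotic`), Thm 2.1 (`bhargavaShankar_classCount`)
and Lemma 5.16 (`brumerKramer_card_quotient_two`), following lines 3–4 of display (31) and
the last display of §5.4. [cite: BhargavaShankarAnnals2015, §5.4 eq. (31) with Prop. 5.12 and Lemma 5.16 (arXiv:1006.1002v2 numbering)] -/
theorem sum_irredClassCount_asymptotic_of_sieve (hG : bhargavaShankar_locSolIrredClassCount_asymptotic)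
    (h16 : bhargavaShankar_classCount) (hBK : brumerKramer_card_quotient_two) :
    bhargavaShankar_sum_irredClassCount_asymptotic := by
  -- notation
  set c₁ : ℝ := (2 : ℝ) ^ 10 * 27 with hc₁
  have hc₁pos : 0 < c₁ := by rw [hc₁]; norm_num
  set κ : ℝ := 8 / 27 * (Real.pi ^ 2 / 6) with hκ
  set P : ℝ := ∏' p : Nat.Primes, ((padicNorm p ((2 : ℚ) ^ 10 / 3 ^ 3) : ℚ) : ℝ) *
    @localMassV p ⟨p.2⟩ with hP
  set E₁₀ : ℝ := ∏' p : Nat.Primes, (1 - 1 / ((p : ℕ) : ℝ) ^ 10) with hE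
  set N' : ℝ → ℝ := fun Y ↦ (gl2zClassCount (fourRealRoots ∪ posDefinite ∪ twoRealRoots) Y : ℝ)
    with hN'
  set L : ℝ → ℝ := fun Y ↦ (locSolIrredClassCount Y : ℝ) with hL
  have hPval : P = ((2 : ℝ) ^ 9)⁻¹ * (3 : ℝ)⁻¹ * (6 / Real.pi ^ 2) * E₁₀ :=
    (hasProd_localFactor hBK).tprod_eq
  -- (1) the sieve step along `X' = (27/4)·X`, rescaled by the constant `(27/4)^{5/6}`
  have hu : Tendsto (fun X : ℕ ↦ (27 / 4 : ℝ) * X) atTop atTop :=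
    Tendsto.const_mul_atTop (by norm_num) tendsto_natCast_atTop_atTop
  have hG0 : Tendsto (fun X : ℝ ↦ (L (2 ^ 12 * X) - N' (2 ^ 12 * X) * P) / X ^ (5 / 6 : ℝ))
      atTop (𝓝 0) := hG
  have hG' : Tendsto (fun X : ℕ ↦ (L (c₁ * X) - N' (c₁ * X) * P) / (X : ℝ) ^ (5 / 6 : ℝ))
      atTop (𝓝 0) := by
    have h := (hG0.comp hu).mul_const ((27 / 4 : ℝ) ^ (5 / 6 : ℝ))
    rw [zero_mul] at h
    refine h.congr' ?_
    filter_upwards [eventually_ge_atTop 1] with X hX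
    have hX0 : (0 : ℝ) < X := by exact_mod_cast hX
    simp only [Function.comp_apply]
    rw [show (2 : ℝ) ^ 12 * (27 / 4 * (X : ℝ)) = c₁ * X by rw [hc₁]; ring,
      Real.mul_rpow (by norm_num) hX0.le]
    have h274 : (0 : ℝ) < (27 / 4 : ℝ) ^ (5 / 6 : ℝ) := Real.rpow_pos_of_pos (by norm_num) _
    field_simp
  -- (2) `N'(c₁X)/X^{5/6} → κ c₁^{5/6}`
  have hN'lim : Tendsto (fun X : ℕ ↦ N' (c₁ * X) / (X : ℝ) ^ (5 / 6 : ℝ)) atTop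
      (𝓝 (κ * c₁ ^ (5 / 6 : ℝ))) := by
    obtain ⟨C, hC⟩ := abs_classCount_union_sub_le h16
    have hdiff : Tendsto (fun X : ℕ ↦ |N' (c₁ * X) - κ * (c₁ * X) ^ (5 / 6 : ℝ)| /
        (X : ℝ) ^ (5 / 6 : ℝ)) atTop (𝓝 0) := by
      refine tendsto_div_rpow_fiveSixths_of_le (C := |C| * c₁ ^ (3 / 4 + 1 / 24 : ℝ))
        (a := 3 / 4 + 1 / 24) (by norm_num) (fun X ↦ abs_nonneg _) fun X hX ↦ ?_
      have hX1 : (1 : ℝ) ≤ X := by exact_mod_cast hX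
      have hY : 1 ≤ c₁ * X := by nlinarith
      calc |N' (c₁ * X) - κ * (c₁ * X) ^ (5 / 6 : ℝ)| ≤ C * (c₁ * X) ^ (3 / 4 + 1 / 24 : ℝ) :=
            hC _ hY
        _ ≤ |C| * (c₁ * X) ^ (3 / 4 + 1 / 24 : ℝ) :=
            mul_le_mul_of_nonneg_right (le_abs_self C) (by positivity)
        _ = |C| * c₁ ^ (3 / 4 + 1 / 24 : ℝ) * (X : ℝ) ^ (3 / 4 + 1 / 24 : ℝ) := by
            rw [Real.mul_rpow hc₁pos.le (by positivity)]; ring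
    have hdiff' : Tendsto (fun X : ℕ ↦ (N' (c₁ * X) - κ * (c₁ * X) ^ (5 / 6 : ℝ)) /
        (X : ℝ) ^ (5 / 6 : ℝ)) atTop (𝓝 0) := by
      rw [tendsto_zero_iff_abs_tendsto_zero]
      refine hdiff.congr fun X ↦ ?_
      simp only [Function.comp_apply]
      rw [abs_div, abs_of_nonneg (by positivity : (0 : ℝ) ≤ (X : ℝ) ^ (5 / 6 : ℝ))]
    have hconst : Tendsto (fun X : ℕ ↦ κ * (c₁ * X) ^ (5 / 6 : ℝ) / (X : ℝ) ^ (5 / 6 : ℝ)) atTop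
        (𝓝 (κ * c₁ ^ (5 / 6 : ℝ))) := by
      refine tendsto_const_nhds.congr' ?_
      filter_upwards [eventually_ge_atTop 1] with X hX
      have hX0 : (0 : ℝ) < X := by exact_mod_cast hX
      rw [Real.mul_rpow hc₁pos.le hX0.le]
      field_simp
    have := hdiff'.add hconst
    rw [zero_add] at this
    refine this.congr' ?_
    filter_upwards [eventually_ge_atTop 1] with X hX
    have hX0 : (0 : ℝ) < (X : ℝ) ^ (5 / 6 : ℝ) := Real.rpow_pos_of_pos (by exact_mod_cast hX) _
    field_simp
    ring
  -- (3) `L(c₁X)/X^{5/6} → P κ c₁^{5/6}`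
  have hLlim : Tendsto (fun X : ℕ ↦ L (c₁ * X) / (X : ℝ) ^ (5 / 6 : ℝ)) atTop
      (𝓝 (κ * c₁ ^ (5 / 6 : ℝ) * P)) := by
    have := hG'.add (hN'lim.mul_const P)
    rw [zero_add] at this
    refine this.congr fun X ↦ ?_
    ring
  -- (4) identify the sum with `L(c₁X)` and the constant with `2 c_F`
  unfold bhargavaShankar_sum_irredClassCount_asymptotic
  have hconst : κ * c₁ ^ (5 / 6 : ℝ) * P = 2 * heightFamilyConstant := by
    rw [hPval, heightFamilyConstant, hκ, hc₁, ← hE]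
    have := eq31_constant
    calc 8 / 27 * (Real.pi ^ 2 / 6) * ((2 : ℝ) ^ 10 * 27) ^ (5 / 6 : ℝ) *
          (((2 : ℝ) ^ 9)⁻¹ * (3 : ℝ)⁻¹ * (6 / Real.pi ^ 2) * E₁₀)
        = (8 / 27 * (Real.pi ^ 2 / 6) * ((2 : ℝ) ^ 10 * 27) ^ (5 / 6 : ℝ) *
            (((2 : ℝ) ^ 9)⁻¹ * (3 : ℝ)⁻¹ * (6 / Real.pi ^ 2))) * E₁₀ := by ring
      _ = 2 * (4 / ((4 : ℝ) ^ (1 / 3 : ℝ) * (27 : ℝ) ^ (1 / 2 : ℝ))) * E₁₀ := by rw [this]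
      _ = 2 * (4 / ((4 : ℝ) ^ (1 / 3 : ℝ) * (27 : ℝ) ^ (1 / 2 : ℝ)) * E₁₀) := by ring
  rw [← hconst]
  refine hLlim.congr fun X ↦ ?_
  simp only [hL]
  rw [← sum_pgl2QClassCount_eq_locSolIrredClassCount h16 X, Nat.cast_sum]

/-! ## Theorem 1.1 and Cor. 1.2 granted Lemma 5.2, the sieve step (†), Thm 2.1 and Lemma 5.16 -/

/-- **Bhargava–Shankar, Theorem 1.1, granted Lemma 5.2, the sieve step (†) of eq. (31), Thm 2.1
and Lemma 5.16** (everything else in the printed derivation being proved in the tree).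
[cite: BhargavaShankarAnnals2015, Thm 1.1 (arXiv:1006.1002v2 numbering)] -/
theorem average_card_selmerTwo_of_sieve_facts
    (h52 : bhargavaShankar_card_selmerTwo_eq_kEquivClassCount)
    (hG : bhargavaShankar_locSolIrredClassCount_asymptotic)
    (h16 : bhargavaShankar_classCount) (hBK : brumerKramer_card_quotient_two) :
    EllipticCurves.average_card_selmerTwo :=
  average_card_selmerTwo_of_two_BS_facts (bhargavaShankar_card_selmerTwo_eq_of_bsd_correspondence h52)
    (sum_irredClassCount_asymptotic_of_sieve hG h16 hBK)

/-- **Bhargava–Shankar, Cor. 1.2 (`averageRankLE_three_halves`), granted Lemma 5.2 (the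
Birch–Swinnerton-Dyer `2`-covering correspondence), the sieve step (†) of eq. (31) (Thm 2.11 +
Props. 5.12–5.13), Thm 2.1 (the geometry-of-numbers count) and Lemma 5.16 (Brumer–Kramer)** —
four single printed statements; all other steps of the paper's derivation of Cor. 1.2 are
theorems of the tree. [cite: BhargavaShankarAnnals2015, Cor. 1.2] -/
theorem averageRankLE_three_halves_of_sieve_facts
    (h52 : bhargavaShankar_card_selmerTwo_eq_kEquivClassCount)
    (hG : bhargavaShankar_locSolIrredClassCount_asymptotic)
    (h16 : bhargavaShankar_classCount) (hBK : brumerKramer_card_quotient_two) :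
    EllipticCurves.averageRankLE_three_halves :=
  averageRankLE_three_halves_of_two_BS_facts (bhargavaShankar_card_selmerTwo_eq_of_bsd_correspondence h52)
    (sum_irredClassCount_asymptotic_of_sieve hG h16 hBK)

/-- The same with Lemma 5.16 replaced by its input, Silverman AEC Prop. VII.6.3 over `ℚ_p`
(`exists_finiteIndex_addEquiv_padicInt`, via `brumerKramer_card_quotient_two_of_AEC`).
[cite: BhargavaShankarAnnals2015, Cor. 1.2] -/
theorem averageRankLE_three_halves_of_sieve_facts_AEC
    (h52 : bhargavaShankar_card_selmerTwo_eq_kEquivClassCount)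
    (hG : bhargavaShankar_locSolIrredClassCount_asymptotic)
    (h16 : bhargavaShankar_classCount) (hAEC : exists_finiteIndex_addEquiv_padicInt) :
    EllipticCurves.averageRankLE_three_halves :=
  averageRankLE_three_halves_of_sieve_facts h52 hG h16 (brumerKramer_card_quotient_two_of_AEC hAEC)

end Literature.NumberTheory.EllipticCurves

end
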